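import Summits.QuantumFields.YangMills.Theorems.BalabanUVNodesN12AtRecord
import Summits.QuantumFields.YangMills.Theorems.BalabanUVNodesN06AtRecord11CB10YZW
import Literature.MathematicalPhysics.QuantumFieldTheory.Balaban1983to89.Node00.Record11CarriersB8

/-!
# BalabanUVNodes ∕ N12 AT THE STAGE-11 RECORD WITH THE [IV] BUNDLE PINNED, `Node00.IsRecordOfRecord₁₁CB10YZW` (and its five-pin sequel
# `…₁₁CB10YZWB8`) — the stub `YMDAG.UVSplit.S_N12 Rec := AtRecord Rec Dag.B15_main` READ, KEYED and CLOSED BY NAME at def-T's `Record11` ∕ node00-def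
# g31's `Record11Carriers(B8)`: the `rBasicStep` leaf IS `B15Leaf (WOfRecord₁₁ θ λ P)`; the KEYED closers deliver `Dag.B15_main (leavesP w P)` from the
# DISPLAYED hypotheses `Node00.WDisplays₁₀ θ.toStage9Params λ P` (pre-𝐑 terms measurable ∕ ≥ 0 ∕ bounded ∕ of positive mass + EXACTLY [IV] Prop. 1 (1.78),
# (1.80), (1.89), (1.102)); the census twin: in ∀-form over the record predicate the leaf is JUNK-REFUTABLE through the residual letters `LF ∕ D189 ∕ D1100`
# (Track A, DAG node N12 = [B15, Balaban1989LargeFieldI] CMP 122 (1989) 175, basic step of 𝐑 (0.1)–(0.6) p.176, Prop. 1 p.194, (1.80), (1.89), (1.99)–(1.102);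
# cluster K1 `StabilityBAtRecordR11e`; seat `pub-ymgap-dag-n12-d` (R134 fan-out, strategy s2 = by-name knit at the ₁₁ record), 2026-08-26; count-neutral)

HONEST FRAMING.  Count-neutral kernel BOOKKEEPING BY NAME over LANDED modules: `Node00.Record11Carriers` (p445559: `IsRecordOfRecord₁₁CB10YZW`, `WOfRecord₁₁ :=
WOfRecord₁₀ ∘ toStage9Params`, `leaves_iff_of_…`, `upOfRecord₅C_view₁₁B10YZW_leaves`, `isRecordOfRecord₁₁C_of_…`, `…_rebind_of_isRecordOfRecord₁₁C`, `atWorld_of_…`),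
`Node00.Record11CarriersB8` (p446171: `IsRecordOfRecord₁₁CB10YZWB8`, `leaves_iff_of_…`, `b4_b5_b6_b7_of_…`, `upOfRecord₅CS_view₁₁B8B10YZW_leaves`), `Node00.CarriersW` (p432637:
`ResidW`, `WDisplays₁₀`, `b15Leaf_WOfRecord₁₀_of_displays` = n12-a's `B15LeafKnitTower9.b15Leaf_WOfTower9_of_mass` at the record's plugs, `not_b15Leaf_WOfRecord₁₀_swapLF`,
`nonempty_residW`), `Node00.Record11` (p444286: `IsRecordOfRecord₁₁C`), NODE 00's ₅C in-edge theorems (`b4∕b5∕b7_main_of_isRecordOfRecord₅C`,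
`N03_at_record₅C`), the N06 seat's ₁₁ module `N06AtRecord11CB10YZW` (`guards_of_…`, `inhabited₁₁CB10YZW_iff_inhabited₁₁C` — ONE public name, imported), and this node's closer-of-record
module `BalabanUVNodesN12AtRecord` (p419528: `S_N12`, `s_N12_antitone`, `s_N12_of_refines₅C_WOfTower9`).  NOT A DISCHARGE OF N12: every closer of §2 takes AS HYPOTHESES,
keyed to the parameter packages presenting the record, the [IV] displays `WDisplays₁₀` — [Balaban1989LargeFieldI]'s Proposition 1 (1.78) on the residual carrier `λ.LF P`,
(1.80) on the ℍ-domains and (1.89) for the residual letters `λ.D189 P`, (1.102) for the residual 𝐑′-data `λ.D1100 P` at `𝐓ρ_k` of record, and the p.176 provisos on the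
pre-𝐑 terms in the chair's (R-C2) MASS reading — TYPED, NOT ASSERTED; §3 proves the ∀-form of the leaf over the record predicate FALSE as soon as the predicate is
inhabited (the residual letters admit junk), one storey up from `not_atRecord_rBasicStep₅C∕₇C∕₈C`.  Inhabitation (K0 `Record11Inhabited`, stmt-QuantumFields-19673) is
neither proved nor assumed: §3 takes it as `hex` («inhabited at ₁₁CB10YZW ⟺ at ₁₁C» is the N06 seat's, by name).  THE STEP READ: every closer reads ONE step
`k := λ.kSel P` per run — whatever the presenting package's residual layer says (node00-def g30's located question «one k, or every k < K» is NOT settled here).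
Nothing of Bałaban's asserted; one finite four-torus programme at fixed `ε`; nothing continuum ∕ ℝ⁴ ∕ infinite volume ∕ OS ∕ mass gap ∕ Clay.  0 `sorry`, 0 `def`,
0 `instance`, standard axioms.  Filed `--supports` K1 `StabilityBAtRecordR11e` (stmt-QuantumFields-19674).

WHAT THIS FILE PROVES.
* §1 READING — `leaf_rBasicStep_iff_of_isRecordOfRecord₁₁CB10YZW(B8)` (the N12 socket at ₁₁: `rBasicStep ↔ B15Leaf (WOfRecord₁₁ θ λ P)`), the residual reading (`Dag.B15_main ⟺ (b8 → b10 → b11 → rBasicStep)`), THE FACE THROUGH THE PINNED BUNDLES `b15_main_iff_bundles_of_…(B8)`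
  (`⟺ (b8 → PrintedUV3V N θ.L → B11Leaf (Z11OfRecord ζ) → B15Leaf (WOfRecord₁₁ θ λ P))`), `s_N12_iff₁₁CB10YZW_bundles`.
* §2 KEYED CLOSERS BY NAME — pointed (`b15_main_of_up_view₁₁B10YZW_of_displays` ∕ `…view₁₁B8B10YZW…`: a world bound over the four-∕five-pin view + the displays at run `P`
  ⇒ `Dag.B15_main` at `P`), per record (`b15_main_of_isRecordOfRecord₁₁CB10YZW(B8)_of_slots ∕ _of_displays`), for every `Rec` refining the predicate
  (`s_N12_of_refines₁₁CB10YZW(B8)_of_displays`), and THE JUNCTION WITH n12-a's CONDITIONAL CLOSER OF RECORD: the hook's pin clause holds by `rfl` at the four-pin view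
  (`view₁₁B10YZW_res_W`: TS-8 instance coherence at ₁₁) and `s_N12_of_refines₁₁CB10YZW_via_WOfTower9` IS ONE APPLICATION of `N12AtRecord.s_N12_of_refines₅C_WOfTower9`.
* §3 CENSUS TWIN — `isRecordOfRecord₁₁CB10YZW_reLayerW`, `not_atRecord_rBasicStep₁₁CB10YZW ∕ ₁₁C` (under `hex`).
* §4 GUARD — `b15Leaf_of_s_N12_record₁₁CB10YZW` (under `S_N12` the leaf is read back at every presented package: §2 proves nothing weaker than the slot).
Sources: [Balaban1989LargeFieldI] (0.2)–(0.6) p.176, Prop. 1 (1.78) p.194, (1.80) p.195, (1.89) p.198, (1.99)–(1.102) pp.200–201; record dictionaries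
[Balaban1988Convergent] (2.18) p.257, (3.25) p.270, [Balaban1989LargeFieldII] Thm 1 + (0.1) pp.355–356.
-/

noncomputable section

open MeasureTheory

namespace Summit.QuantumFields.YangMills.BalabanUVNodes.N12AtRecord11CB10YZW

open Literature.MathematicalPhysics.QuantumFieldTheory.Balaban1983to89
open Literature.MathematicalPhysics.QuantumFieldTheory.Balaban1983to89.T4Continuum (T4Family FiniteEpsData)
open Literature.MathematicalPhysics.QuantumFieldTheory.Balaban1983to89.DagBinding (WorldP leavesP PrintedCarriers15 B15Leaf B9LeafX B11Leaf)
open Literature.MathematicalPhysics.QuantumFieldTheory.Balaban1983to89.Node00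
open YMDAG.UVSplit (RecordPred Datum AtRecord S_N12)
open Summit.QuantumFields.YangMills.BalabanUVNodes.N12AtRecord (s_N12_antitone s_N12_of_refines₅C_WOfTower9)
open Summit.QuantumFields.YangMills.BalabanUVNodes.N06AtRecord11CB10YZW (guards_of_isRecordOfRecord₁₁CB10YZW inhabited₁₁CB10YZW_iff_inhabited₁₁C)

variable {N : ℕ} [NeZero N]

/-! ## §1 READING — the N12 socket at ₁₁, the in-edge guards, the residual reading, the face through the pinned bundles -/

section Reading

variable {F : T4Family} {D : Datum F N} {w : WorldP}

/-- **THE N12 SOCKET AT A STAGE-11 RECORD WITH THE [IV] BUNDLE PINNED**: for one package presenting `(D, w)`, at every run the `rBasicStep` leaf IS the [IV] leaf at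
the bundle of record `WOfRecord₁₁ θ λ P` (n12-a's `WOfRepr` at `Tstep rep_k` of the tower of record, step `k := λ.kSel P`, selector ∕ fibre bonds of record, residual
letters `λ.LF ∕ λ.D189 ∕ λ.D1100`) — g31's `leaves_iff_of_isRecordOfRecord₁₁CB10YZW` BY NAME. [cite: Balaban1989LargeFieldI, Prop. 1 p.194, (0.4)–(0.6) p.176, (1.89) p.198, (1.102) p.201 (the leaf at the objects of record; bookkeeping)] -/
theorem leaf_rBasicStep_iff_of_isRecordOfRecord₁₁CB10YZW (h : IsRecordOfRecord₁₁CB10YZW F N D w) :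
    ∃ (θ : Stage11Params F N) (lamW : ResidW F N), θ.Admissible ∧
      ∀ P : B12.RunParams, (leavesP w P).rBasicStep ↔ B15Leaf (WOfRecord₁₁ F N θ lamW P) := by
  obtain ⟨θ, _, _, _, lamW, hθ, -, hl⟩ := leaves_iff_of_isRecordOfRecord₁₁CB10YZW h
  exact ⟨θ, lamW, hθ, fun P => (hl P).1⟩

/-- **The same socket at the five-pin record** (`…B8`, the S-binding; g31's `leaves_iff_of_isRecordOfRecord₁₁CB10YZWB8` BY NAME).
[cite: Balaban1989LargeFieldI, Prop. 1 p.194, (0.4)–(0.6) p.176 (bookkeeping)] -/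
theorem leaf_rBasicStep_iff_of_isRecordOfRecord₁₁CB10YZWB8 (h : IsRecordOfRecord₁₁CB10YZWB8 F N D w) :
    ∃ (θ : Stage11Params F N) (lamW : ResidW F N), θ.Admissible ∧
      ∀ P : B12.RunParams, (leavesP w P).rBasicStep ↔ B15Leaf (WOfRecord₁₁ F N θ lamW P) := by
  obtain ⟨θ, _, _, _, _, lamW, hθ, -, hl⟩ := leaves_iff_of_isRecordOfRecord₁₁CB10YZWB8 h
  exact ⟨θ, lamW, hθ, fun P => (hl P).2.1⟩

/-- **N12 at a ₁₁CB10YZW record, the RESIDUAL READING**: at every run `Dag.B15_main ⟺ (b8 → b10 → b11 → rBasicStep)` — the discharged in-edges `b5`, `b7` drop out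
by the guards `b4 b5 b6 b7` (NODE 00's N01–N04 at the Stage-5 shadow, transferred; the N06 seat's `N06AtRecord11CB10YZW.guards_of_isRecordOfRecord₁₁CB10YZW` BY NAME),
so no closer below is vacuous through an in-edge. [cite: Balaban1989LargeFieldI, Prop. 1 p.194, (0.2)–(0.6) p.176 (the node's shape `Dag.B15_main`; bookkeeping)] -/
theorem b15_main_iff_residual_of_isRecordOfRecord₁₁CB10YZW (h : IsRecordOfRecord₁₁CB10YZW F N D w) (P : B12.RunParams) :
    Dag.B15_main (leavesP w P) ↔ ((leavesP w P).b8 → (leavesP w P).b10 → (leavesP w P).b11 → (leavesP w P).rBasicStep) := by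
  obtain ⟨-, h5, -, h7⟩ := guards_of_isRecordOfRecord₁₁CB10YZW h P
  exact ⟨fun H h8 h10 h11 => H h5 h7 h8 h10 h11, fun H _ _ h8 h10 h11 => H h8 h10 h11⟩

/-- **THE FACE AT ₁₁ THROUGH THE PINNED BUNDLES**: for one parameter package `(θ, ζ, λ)` presenting the record (the [B9] floor ∕ operator layer do not enter
`Dag.B15_main`), at every run
`Dag.B15_main ⟺ (b8 → PrintedUV3V N θ.L → B11Leaf (Z11OfRecord F N ζ) → B15Leaf (WOfRecord₁₁ F N θ λ P))` — the in-edges `b10` ([B10], N08) and `b11` ([B11], N07) are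
the PINNED bundle leaves of g31's `leaves_iff_of_isRecordOfRecord₁₁CB10YZW`, `b8` ([B8] group, unpinned at this record) stays a world leaf, and the conclusion is the
[IV] leaf at the bundle of record. [cite: Balaban1989LargeFieldI, Prop. 1 p.194, (0.4)–(0.6) p.176; Balaban1985UV3, Thm 1 p.257; Balaban1985Variational, Thm 1 p.279 (the pinned objects; bookkeeping)] -/
theorem b15_main_iff_bundles_of_isRecordOfRecord₁₁CB10YZW (h : IsRecordOfRecord₁₁CB10YZW F N D w) :
    ∃ (θ : Stage11Params F N) (ζ : ResidZ F N) (lamW : ResidW F N), θ.Admissible ∧ w.L = (θ.L : ℝ) ∧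
      ∀ P : B12.RunParams,
        (Dag.B15_main (leavesP w P) ↔
          ((leavesP w P).b8 → PrintedUV3V N θ.L → B11Leaf (Z11OfRecord F N ζ) → B15Leaf (WOfRecord₁₁ F N θ lamW P))) := by
  obtain ⟨θ, _, _, ζ, lamW, hθ, hL, hl⟩ := leaves_iff_of_isRecordOfRecord₁₁CB10YZW h
  refine ⟨θ, ζ, lamW, hθ, hL, fun P => ?_⟩
  rw [b15_main_iff_residual_of_isRecordOfRecord₁₁CB10YZW h P, (hl P).1, (hl P).2.2.1, (hl P).2.2.2]

/-- **The five-pin face**: at a `…₁₁CB10YZWB8` record, for one package `(θ, lam8, ζ, λ)`, at every run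
`Dag.B15_main ⟺ (B8LeafOfRecord θ₃ lam8 → PrintedUV3V N θ.L → B11Leaf (Z11OfRecord F N ζ) → B15Leaf (WOfRecord₁₁ F N θ λ P))` — all four antecedent ∕ consequent leaves
are pinned bundle leaves (g31's `leaves_iff_of_isRecordOfRecord₁₁CB10YZWB8`, `b4_b5_b6_b7_of_…`). [cite: Balaban1989LargeFieldI, Prop. 1 p.194; Balaban1985RegularSpaces, Thm 2 p.83; Balaban1985UV3, Thm 1 p.257; Balaban1985Variational, Thm 1 p.279 (bookkeeping)] -/
theorem b15_main_iff_bundles_of_isRecordOfRecord₁₁CB10YZWB8 (h : IsRecordOfRecord₁₁CB10YZWB8 F N D w) :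
    ∃ (θ : Stage11Params F N) (lam : ResidB8 θ.toStage3Params) (ζ : ResidZ F N) (lamW : ResidW F N),
      θ.Admissible ∧ w.L = (θ.L : ℝ) ∧ ∀ P : B12.RunParams,
        (Dag.B15_main (leavesP w P) ↔
          (B8LeafOfRecord θ.toStage3Params lam → PrintedUV3V N θ.L → B11Leaf (Z11OfRecord F N ζ) → B15Leaf (WOfRecord₁₁ F N θ lamW P))) := by
  obtain ⟨θ, lam, _, _, ζ, lamW, hθ, hL, hl⟩ := leaves_iff_of_isRecordOfRecord₁₁CB10YZWB8 h
  refine ⟨θ, lam, ζ, lamW, hθ, hL, fun P => ?_⟩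
  obtain ⟨-, h5, -, h7⟩ := b4_b5_b6_b7_of_isRecordOfRecord₁₁CB10YZWB8 h P
  have hres : Dag.B15_main (leavesP w P) ↔ ((leavesP w P).b8 → (leavesP w P).b10 → (leavesP w P).b11 → (leavesP w P).rBasicStep) :=
    ⟨fun H h8 h10 h11 => H h5 h7 h8 h10 h11, fun H _ _ h8 h10 h11 => H h8 h10 h11⟩
  rw [hres, (hl P).1, (hl P).2.1, (hl P).2.2.2.1, (hl P).2.2.2.2]

end Reading

/-- **`S_N12` AT THE STAGE-11 W-PINNED RECORD, THROUGH THE PINNED BUNDLES, EXACTLY**: ⟺ «for every parameter package `(θ, h, Mstar, ops, ζ, λ)` of an admissible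
Stage-11 parameter with its provisos and every world bound over the four-pin view `θ.view₁₁B10YZW Mstar ops ζ λ` (datum `datumOfRecord₁₁ F N θ h`, window
`0 < γ ≤ θ.γ`, block size `θ.L`), at every run: `b8 → PrintedUV3V N θ.L → B11Leaf (Z11OfRecord F N ζ) → B15Leaf (WOfRecord₁₁ F N θ λ P)`».  The in-edges enter by
their pinned bundle leaves; neither they nor the [IV] leaf are claimed. [cite: Balaban1989LargeFieldI, Prop. 1 p.194, (0.2)–(0.6) p.176; Balaban1989LargeFieldII, Thm 1 + (0.1) pp.355–356 (bookkeeping)] -/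
theorem s_N12_iff₁₁CB10YZW_bundles :
    S_N12 (fun F D w => IsRecordOfRecord₁₁CB10YZW F N D w) ↔
      ∀ (F : T4Family) (θ : Stage11Params F N) (h : θ.Provisos₁₁) (Mstar : ℕ) (ops : OpsY N θ.toStage3Params Mstar) (ζ : ResidZ F N) (lamW : ResidW F N)
        (w : WorldP), θ.Admissible → w.C = (datumOfRecord₁₁ F N θ h).C → (0 < w.γ ∧ w.γ ≤ θ.γ) → w.L = (θ.L : ℝ) →
        (∀ P, w.up P = upOfRecord₅C F N (θ.view₁₁B10YZW F N Mstar ops ζ lamW) P) →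
          ∀ P : B12.RunParams, (leavesP w P).b8 → PrintedUV3V N θ.L → B11Leaf (Z11OfRecord F N ζ) → B15Leaf (WOfRecord₁₁ F N θ lamW P) := by
  refine ⟨fun hS F θ hP Mstar ops ζ lamW w hθ hC hγ hL hup P h8 h10 h11 => ?_, fun H F D w h P => ?_⟩
  · have hrec : IsRecordOfRecord₁₁CB10YZW F N (datumOfRecord₁₁ F N θ hP) w := ⟨θ, hP, Mstar, ops, ζ, lamW, hθ, rfl, hC, hγ, hL, hup⟩
    have hl := upOfRecord₅C_view₁₁B10YZW_leaves F N θ Mstar ops ζ lamW P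
    obtain ⟨-, h5, -, h7⟩ := guards_of_isRecordOfRecord₁₁CB10YZW hrec P
    have h10' : (leavesP w P).b10 := by
      show (w.up P).b10
      rw [hup P]; exact hl.2.2.1.2 h10
    have h11' : (leavesP w P).b11 := by
      show (w.up P).b11
      rw [hup P]; exact hl.2.2.2.2 h11
    have hr : (leavesP w P).rBasicStep := hS F _ w hrec P h5 h7 h8 h10' h11'
    have hr' : (w.up P).rBasicStep := hr
    rw [hup P] at hr'
    exact hl.1.1 hr'
  · obtain ⟨θ, hP, Mstar, ops, ζ, lamW, hθ, hD, hC, hγ, hL, hup⟩ := h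
    subst hD
    have hl := upOfRecord₅C_view₁₁B10YZW_leaves F N θ Mstar ops ζ lamW P
    intro _ _ h8 h10 h11
    have h10' : PrintedUV3V N θ.L := by
      have : (w.up P).b10 := h10
      rw [hup P] at this; exact hl.2.2.1.1 this
    have h11' : B11Leaf (Z11OfRecord F N ζ) := by
      have : (w.up P).b11 := h11
      rw [hup P] at this; exact hl.2.2.2.1 this
    show (w.up P).rBasicStep
    rw [hup P]
    exact hl.1.2 (H F θ hP Mstar ops ζ lamW w hθ hC hγ hL hup P h8 h10' h11')

/-! ## §2 KEYED CLOSERS BY NAME — from the DISPLAYED [IV] hypotheses `Node00.WDisplays₁₀` at the presenting packages, nothing else -/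

section Closers

variable {F : T4Family} {D : Datum F N} {w : WorldP}

/-- **The [IV] leaf at the Stage-11 bundle of record FROM THE DISPLAYS** (g30's `b15Leaf_WOfRecord₁₀_of_displays` BY NAME at `θ.toStage9Params`; `WOfRecord₁₁ θ := WOfRecord₁₀
θ.toStage9Params` is g31's `rfl`; (0.4) and (0.6) are n12-a's THEOREMS `B15LeafKnitTower9.b15Leaf_WOfTower9_of_mass`, the four printed statements displayed).
[cite: Balaban1989LargeFieldI, (0.2)–(0.6) p.176, Prop. 1 (1.78) p.194, (1.80) p.195, (1.89) p.198, (1.102) p.201] -/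
theorem b15Leaf_WOfRecord₁₁_of_displays {θ : Stage11Params F N} {lamW : ResidW F N} {P : B12.RunParams} (hd : WDisplays₁₀ θ.toStage9Params lamW P) :
    B15Leaf (WOfRecord₁₁ F N θ lamW P) :=
  b15Leaf_WOfRecord₁₀_of_displays hd

/-- **POINTED CLOSER, four-pin view** (no record hypothesis): a world bound at run `P` over the four-pin Stage-11 view `θ.view₁₁B10YZW Mstar ops ζ λ` satisfies
`Dag.B15_main` at `P` as soon as the [IV] displays hold at `(θ.toStage9Params, λ, P)` — in-edges unused. [cite: Balaban1989LargeFieldI, Prop. 1 (1.78) p.194, (0.2)–(0.6) p.176, (1.80) p.195, (1.89) p.198, (1.102) p.201] -/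
theorem b15_main_of_up_view₁₁B10YZW_of_displays (θ : Stage11Params F N) (Mstar : ℕ) (ops : OpsY N θ.toStage3Params Mstar) (ζ : ResidZ F N)
    (lamW : ResidW F N) {P : B12.RunParams} (hup : w.up P = upOfRecord₅C F N (θ.view₁₁B10YZW F N Mstar ops ζ lamW) P)
    (hd : WDisplays₁₀ θ.toStage9Params lamW P) : Dag.B15_main (leavesP w P) := by
  intro _ _ _ _ _
  show (w.up P).rBasicStep
  rw [hup]
  exact (upOfRecord₅C_view₁₁B10YZW_leaves F N θ Mstar ops ζ lamW P).1.2 (b15Leaf_WOfRecord₁₁_of_displays hd)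

/-- **POINTED CLOSER, five-pin view** (S-binding; no record hypothesis). [cite: Balaban1989LargeFieldI, Prop. 1 (1.78) p.194, (0.2)–(0.6) p.176, (1.80) p.195, (1.89) p.198, (1.102) p.201] -/
theorem b15_main_of_up_view₁₁B8B10YZW_of_displays (θ : Stage11Params F N) (lam : ResidB8 θ.toStage3Params) (Mstar : ℕ) (ops : OpsY N θ.toStage3Params Mstar)
    (ζ : ResidZ F N) (lamW : ResidW F N) {P : B12.RunParams} (hup : w.up P = upOfRecord₅CS F N (θ.view₁₁B8B10YZW F N lam Mstar ops ζ lamW) P)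
    (hd : WDisplays₁₀ θ.toStage9Params lamW P) : Dag.B15_main (leavesP w P) := by
  intro _ _ _ _ _
  show (w.up P).rBasicStep
  rw [hup]
  exact (upOfRecord₅CS_view₁₁B8B10YZW_leaves F N θ lam Mstar ops ζ lamW P).2.1.2 (b15Leaf_WOfRecord₁₁_of_displays hd)

/-- **N12 «SLOTS» FORM at a ₁₁CB10YZW record** (g31's `b9_b11_b15_main_of_isRecordOfRecord₁₁CB10YZW_of_slots`, the [IV] conjunct alone): if for every parameter package
presenting `(D, w)` the [IV] leaf holds at the bundle of record at every run, then `Dag.B15_main` holds at every run.  The hypothesis quantifies over the HIDDEN residual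
layers — honest, and why N12 is not bookable in ∀-form over this predicate (§3). [cite: Balaban1989LargeFieldI, Prop. 1 p.194, (0.2)–(0.6) p.176 (bookkeeping)] -/
theorem b15_main_of_isRecordOfRecord₁₁CB10YZW_of_slots (h : IsRecordOfRecord₁₁CB10YZW F N D w)
    (hW : ∀ (θ : Stage11Params F N) (hP : θ.Provisos₁₁) (Mstar : ℕ) (ops : OpsY N θ.toStage3Params Mstar) (ζ : ResidZ F N) (lamW : ResidW F N),
      θ.Admissible → D = datumOfRecord₁₁ F N θ hP → (∀ P, w.up P = upOfRecord₅C F N (θ.view₁₁B10YZW F N Mstar ops ζ lamW) P) →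
        ∀ P : B12.RunParams, B15Leaf (WOfRecord₁₁ F N θ lamW P))
    (P : B12.RunParams) : Dag.B15_main (leavesP w P) := by
  obtain ⟨θ, hP, Mstar, ops, ζ, lamW, hθ, hD, -, -, -, hup⟩ := h
  intro _ _ _ _ _
  show (w.up P).rBasicStep
  rw [hup P]
  exact (upOfRecord₅C_view₁₁B10YZW_leaves F N θ Mstar ops ζ lamW P).1.2 (hW θ hP Mstar ops ζ lamW hθ hD hup P)

/-- **N12 OF RECORD AT A ₁₁CB10YZW RECORD, DISPLAYED-HYPOTHESES FORM** — the discharge SHAPE of N12 at Stage 11 modulo [IV]'s printed estimates (g30's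
`b15_main_of_isRecordOfRecord₁₀CB10YZW_of_displays` one storey up): if every parameter package presenting `(D, w)` supplies `WDisplays₁₀ θ.toStage9Params λ P` at every run,
then `Dag.B15_main` holds at every run.  NOT a discharge. [cite: Balaban1989LargeFieldI, Prop. 1 (1.78) p.194, (0.2)–(0.6) p.176, (1.80) p.195, (1.89) p.198, (1.102) p.201] -/
theorem b15_main_of_isRecordOfRecord₁₁CB10YZW_of_displays (h : IsRecordOfRecord₁₁CB10YZW F N D w)
    (hdisp : ∀ (θ : Stage11Params F N) (hP : θ.Provisos₁₁) (Mstar : ℕ) (ops : OpsY N θ.toStage3Params Mstar) (ζ : ResidZ F N) (lamW : ResidW F N),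
      θ.Admissible → D = datumOfRecord₁₁ F N θ hP → (∀ P, w.up P = upOfRecord₅C F N (θ.view₁₁B10YZW F N Mstar ops ζ lamW) P) →
        ∀ P : B12.RunParams, WDisplays₁₀ θ.toStage9Params lamW P)
    (P : B12.RunParams) : Dag.B15_main (leavesP w P) :=
  b15_main_of_isRecordOfRecord₁₁CB10YZW_of_slots h
    (fun θ hP Mstar ops ζ lamW hθ hD hup Q => b15Leaf_WOfRecord₁₁_of_displays (hdisp θ hP Mstar ops ζ lamW hθ hD hup Q)) P

/-- **N12 «SLOTS» FORM at the five-pin record `…₁₁CB10YZWB8`** (S-binding). [cite: Balaban1989LargeFieldI, Prop. 1 p.194, (0.2)–(0.6) p.176 (bookkeeping)] -/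
theorem b15_main_of_isRecordOfRecord₁₁CB10YZWB8_of_slots (h : IsRecordOfRecord₁₁CB10YZWB8 F N D w)
    (hW : ∀ (θ : Stage11Params F N) (hP : θ.Provisos₁₁) (lam : ResidB8 θ.toStage3Params) (Mstar : ℕ) (ops : OpsY N θ.toStage3Params Mstar) (ζ : ResidZ F N)
      (lamW : ResidW F N), θ.Admissible → D = datumOfRecord₁₁ F N θ hP →
        (∀ P, w.up P = upOfRecord₅CS F N (θ.view₁₁B8B10YZW F N lam Mstar ops ζ lamW) P) → ∀ P : B12.RunParams, B15Leaf (WOfRecord₁₁ F N θ lamW P))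
    (P : B12.RunParams) : Dag.B15_main (leavesP w P) := by
  obtain ⟨θ, hP, lam, Mstar, ops, ζ, lamW, hθ, hD, -, -, -, hup⟩ := h
  intro _ _ _ _ _
  show (w.up P).rBasicStep
  rw [hup P]
  exact (upOfRecord₅CS_view₁₁B8B10YZW_leaves F N θ lam Mstar ops ζ lamW P).2.1.2 (hW θ hP lam Mstar ops ζ lamW hθ hD hup P)

/-- **N12 OF RECORD AT THE FIVE-PIN RECORD, DISPLAYED-HYPOTHESES FORM.** [cite: Balaban1989LargeFieldI, Prop. 1 (1.78) p.194, (0.2)–(0.6) p.176, (1.80) p.195, (1.89) p.198, (1.102) p.201] -/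
theorem b15_main_of_isRecordOfRecord₁₁CB10YZWB8_of_displays (h : IsRecordOfRecord₁₁CB10YZWB8 F N D w)
    (hdisp : ∀ (θ : Stage11Params F N) (hP : θ.Provisos₁₁) (lam : ResidB8 θ.toStage3Params) (Mstar : ℕ) (ops : OpsY N θ.toStage3Params Mstar) (ζ : ResidZ F N)
      (lamW : ResidW F N), θ.Admissible → D = datumOfRecord₁₁ F N θ hP →
        (∀ P, w.up P = upOfRecord₅CS F N (θ.view₁₁B8B10YZW F N lam Mstar ops ζ lamW) P) → ∀ P : B12.RunParams, WDisplays₁₀ θ.toStage9Params lamW P)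
    (P : B12.RunParams) : Dag.B15_main (leavesP w P) :=
  b15_main_of_isRecordOfRecord₁₁CB10YZWB8_of_slots h
    (fun θ hP lam Mstar ops ζ lamW hθ hD hup Q => b15Leaf_WOfRecord₁₁_of_displays (hdisp θ hP lam Mstar ops ζ lamW hθ hD hup Q)) P

end Closers

/-- **`S_N12 Rec` FOR EVERY RECORD PREDICATE REFINING THE STAGE-11 W-PINNED RECORD, FROM THE DISPLAYS KEYED TO THE PRESENTING PACKAGES** — the closer the K1 assembly
consumes at any `Rec ⊆ ₁₁CB10YZW`: per `Rec`-pair, every package presenting it supplies the [IV] displays at every run ⇒ `S_N12 Rec` (in-edges unused).  NOT-A-DISCHARGE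
until the displays are inhabited at the objects of record. [cite: Balaban1989LargeFieldI, Prop. 1 (1.78) p.194, (0.2)–(0.6) p.176, (1.80) p.195, (1.89) p.198, (1.102) p.201] -/
theorem s_N12_of_refines₁₁CB10YZW_of_displays (Rec : RecordPred N)
    (href : ∀ (F : T4Family) (D : Datum F N) (w : WorldP), Rec F D w → IsRecordOfRecord₁₁CB10YZW F N D w)
    (hdisp : ∀ (F : T4Family) (D : Datum F N) (w : WorldP), Rec F D w →
      ∀ (θ : Stage11Params F N) (hP : θ.Provisos₁₁) (Mstar : ℕ) (ops : OpsY N θ.toStage3Params Mstar) (ζ : ResidZ F N) (lamW : ResidW F N),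
        θ.Admissible → D = datumOfRecord₁₁ F N θ hP → (∀ P, w.up P = upOfRecord₅C F N (θ.view₁₁B10YZW F N Mstar ops ζ lamW) P) →
          ∀ P : B12.RunParams, WDisplays₁₀ θ.toStage9Params lamW P) :
    S_N12 Rec :=
  fun F D w hR P => b15_main_of_isRecordOfRecord₁₁CB10YZW_of_displays (href F D w hR) (hdisp F D w hR) P

/-- **The same closer at the five-pin record predicate `…₁₁CB10YZWB8`** (S-binding). [cite: Balaban1989LargeFieldI, Prop. 1 (1.78) p.194, (0.2)–(0.6) p.176, (1.80) p.195, (1.89) p.198, (1.102) p.201] -/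
theorem s_N12_of_refines₁₁CB10YZWB8_of_displays (Rec : RecordPred N)
    (href : ∀ (F : T4Family) (D : Datum F N) (w : WorldP), Rec F D w → IsRecordOfRecord₁₁CB10YZWB8 F N D w)
    (hdisp : ∀ (F : T4Family) (D : Datum F N) (w : WorldP), Rec F D w →
      ∀ (θ : Stage11Params F N) (hP : θ.Provisos₁₁) (lam : ResidB8 θ.toStage3Params) (Mstar : ℕ) (ops : OpsY N θ.toStage3Params Mstar) (ζ : ResidZ F N)
        (lamW : ResidW F N), θ.Admissible → D = datumOfRecord₁₁ F N θ hP →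
          (∀ P, w.up P = upOfRecord₅CS F N (θ.view₁₁B8B10YZW F N lam Mstar ops ζ lamW) P) → ∀ P : B12.RunParams, WDisplays₁₀ θ.toStage9Params lamW P) :
    S_N12 Rec :=
  fun F D w hR P => b15_main_of_isRecordOfRecord₁₁CB10YZWB8_of_displays (href F D w hR) (hdisp F D w hR) P

/-- **THE HOOK'S PIN CLAUSE HOLDS BY `rfl` AT THE FOUR-PIN STAGE-11 VIEW** (TS-8 instance coherence at ₁₁): the view's `res.W Pr` IS n12-a's `WOfRepr` read at
`Tstep rep_k` of the tower of record (`repTOfRecord9` at the Stage-10 plugs `EOfRecord₁₀ ∕ wOfRecord₉ ∕ gOfRecord₁₀` of `θ.toStage9Params`), step `λ.kSel Pr`, the selector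
and fibre bonds of record, the residual letters. [cite: Balaban1989LargeFieldI, (0.2)–(0.6) p.176; Balaban1988Convergent, (2.18) p.257, (3.25) p.270 (bookkeeping)] -/
theorem view₁₁B10YZW_res_W {F : T4Family} (θ : Stage11Params F N) (Mstar : ℕ) (ops : OpsY N θ.toStage3Params Mstar) (ζ : ResidZ F N) (lamW : ResidW F N)
    (Pr : B12.RunParams) :
    (θ.view₁₁B10YZW F N Mstar ops ζ lamW).res.W Pr =
      B15LeafKnitRepr.WOfRepr (repTOfRecord9 F N θ.ν θ.τ9 (EOfRecord₁₀ F N θ.toStage9Params) (wOfRecord₉ F N θ.toStage9Params) θ.ppSel Pr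
          (gOfRecord₁₀ F N θ.toStage9Params Pr) (lamW.kSel Pr))
        (θ.ppSel Pr (gOfRecord₁₀ F N θ.toStage9Params Pr) (lamW.kSel Pr + 1))
        (fibOfSeq F θ.ν θ.τ9 Pr (gOfRecord₁₀ F N θ.toStage9Params Pr) (lamW.kSel Pr + 1)) (lamW.LF Pr) (lamW.D189 Pr) (lamW.D1100 Pr) := rfl

/-- **JUNCTION — `S_N12 Rec` for `Rec ⊆ ₁₁CB10YZW` IS ONE APPLICATION OF n12-a's CONDITIONAL CLOSER OF RECORD `N12AtRecord.s_N12_of_refines₅C_WOfTower9`**: refinement type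
`Θ F :=` the presenting packages `(θ, h, Mstar, ops, ζ, λ)`, `toS5 :=` the four-pin view, `Adm π :=` «`π.1` admissible and `π` presents some `Rec`-pair», `hpin := rfl`
(`view₁₁B10YZW_res_W`), the eight display families read off the keyed `WDisplays₁₀`.  Same content as `s_N12_of_refines₁₁CB10YZW_of_displays`, routed through the hook by name.
[cite: Balaban1989LargeFieldI, Prop. 1 (1.78) p.194, (0.2)–(0.6) p.176, (1.80) p.195, (1.89) p.198, (1.102) p.201; Balaban1988Convergent, (2.18) p.257, (3.25) p.270] -/
theorem s_N12_of_refines₁₁CB10YZW_via_WOfTower9 (Rec : RecordPred N)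
    (href : ∀ (F : T4Family) (D : Datum F N) (w : WorldP), Rec F D w → IsRecordOfRecord₁₁CB10YZW F N D w)
    (hdisp : ∀ (F : T4Family) (D : Datum F N) (w : WorldP), Rec F D w →
      ∀ (θ : Stage11Params F N) (hP : θ.Provisos₁₁) (Mstar : ℕ) (ops : OpsY N θ.toStage3Params Mstar) (ζ : ResidZ F N) (lamW : ResidW F N),
        θ.Admissible → D = datumOfRecord₁₁ F N θ hP → (∀ P, w.up P = upOfRecord₅C F N (θ.view₁₁B10YZW F N Mstar ops ζ lamW) P) →
          ∀ P : B12.RunParams, WDisplays₁₀ θ.toStage9Params lamW P) :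
    S_N12 Rec := by
  let Θ : T4Family → Type _ := fun F =>
    Σ' (θ : Stage11Params F N) (_ : θ.Provisos₁₁) (Mstar : ℕ) (_ : OpsY N θ.toStage3Params Mstar) (_ : ResidZ F N), ResidW F N
  let toS5 : ∀ F, Θ F → Stage5Params F N := fun F π => π.1.view₁₁B10YZW F N π.2.2.1 π.2.2.2.1 π.2.2.2.2.1 π.2.2.2.2.2
  let Adm : ∀ F, Θ F → Prop := fun F π => π.1.Admissible ∧ ∃ (D : Datum F N) (w : WorldP), Rec F D w ∧ D = datumOfRecord₁₁ F N π.1 π.2.1 ∧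
    ∀ P, w.up P = upOfRecord₅C F N (toS5 F π) P
  have hd : ∀ F (π : Θ F), Adm F π → ∀ P, WDisplays₁₀ π.1.toStage9Params π.2.2.2.2.2 P := by
    rintro F ⟨θ, hP, Mstar, ops, ζ, lamW⟩ ⟨hθ, D, w, hR, hD, hup⟩ P
    exact hdisp F D w hR θ hP Mstar ops ζ lamW hθ hD hup P
  refine s_N12_of_refines₅C_WOfTower9 Rec toS5 Adm (fun F π => π.1.ν) (fun F π => π.1.τ9) (fun F π => EOfRecord₁₀ F N π.1.toStage9Params)
    (fun F π => wOfRecord₉ F N π.1.toStage9Params) (fun F π => π.1.ppSel) (fun F π P => gOfRecord₁₀ F N π.1.toStage9Params P)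
    (fun F π P => π.2.2.2.2.2.kSel P) (fun F π P => π.2.2.2.2.2.LF P) (fun F π P => π.2.2.2.2.2.D189 P) (fun F π P => π.2.2.2.2.2.D1100 P)
    (fun F D w hR => ?_) (fun F π _ Pr => rfl)
    (fun F π h P => (hd F π h P).hm) (fun F π h P => (hd F π h P).h0) (fun F π h P => (hd F π h P).hC) (fun F π h P => (hd F π h P).hmass)
    (fun F π h P => (hd F π h P).hP1) (fun F π h P => (hd F π h P).h180) (fun F π h P => (hd F π h P).h189) (fun F π h P => (hd F π h P).h1102)
  obtain ⟨θ, hP, Mstar, ops, ζ, lamW, hθ, hD, -, -, -, hup⟩ := href F D w hR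
  exact ⟨⟨θ, hP, Mstar, ops, ζ, lamW⟩, ⟨hθ, D, w, hR, hD, hup⟩, hup⟩

/-- **`S_N12 (₁₁C) → S_N12 (₁₁CB10YZW)`** (antitone along g31's same-world refinement `isRecordOfRecord₁₁C_of_isRecordOfRecord₁₁CB10YZW`; the route's `Rec` of record at
rev 1 is ₁₁C).  The converse does NOT hold by rebinding: a ₁₁C record re-binds to a ₁₁CB10YZW record with the same datum but a RE-BOUND world. [cite: Balaban1989LargeFieldII, Thm 1 + (0.1) pp.355–356 (bookkeeping)] -/
theorem s_N12_record₁₁CB10YZW_of_s_N12_record₁₁C (h : S_N12 (fun F D w => IsRecordOfRecord₁₁C F N D w)) :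
    S_N12 (fun F D w => IsRecordOfRecord₁₁CB10YZW F N D w) :=
  s_N12_antitone (fun _ _ _ hR => isRecordOfRecord₁₁C_of_isRecordOfRecord₁₁CB10YZW hR) h

/-! ## §3 CENSUS TWIN — in ∀-form over the record predicate the [IV] leaf is JUNK-REFUTABLE through the residual letters (one storey up from ₅C ∕ ₇C ∕ ₈C) -/

section Census

variable {F : T4Family} {D : Datum F N} {w : WorldP}

/-- **RE-LAYERING THE [IV] RESIDUAL DATA KEEPS THE RECORD**: a ₁₁CB10YZW record's world, re-bound over the four-pin view with ANY other residual [IV] layer `λ′` (same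
`θ`, floor, operator layer, [B11] layer), is again a ₁₁CB10YZW record with the SAME datum (datum, construction, window, block size are blind to `λ`).
[cite: Balaban1989LargeFieldII, Thm 1 + (0.1) pp.355–356 (bookkeeping: the record predicate)] -/
theorem isRecordOfRecord₁₁CB10YZW_reLayerW (h : IsRecordOfRecord₁₁CB10YZW F N D w) :
    ∃ (θ : Stage11Params F N) (Mstar : ℕ) (ops : OpsY N θ.toStage3Params Mstar) (ζ : ResidZ F N) (lamW : ResidW F N), θ.Admissible ∧
      (∀ P, w.up P = upOfRecord₅C F N (θ.view₁₁B10YZW F N Mstar ops ζ lamW) P) ∧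
      ∀ lamW' : ResidW F N,
        IsRecordOfRecord₁₁CB10YZW F N D { w with up := fun P => upOfRecord₅C F N (θ.view₁₁B10YZW F N Mstar ops ζ lamW') P } := by
  obtain ⟨θ, hP, Mstar, ops, ζ, lamW, hθ, hD, hC, hγ, hL, hup⟩ := h
  exact ⟨θ, Mstar, ops, ζ, lamW, hθ, hup, fun lamW' => ⟨θ, hP, Mstar, ops, ζ, lamW', hθ, hD, hC, hγ, hL, fun _ => rfl⟩⟩

/-- The junk [IV] layer of g30's `not_b15Leaf_WOfRecord₁₀_swapLF`: the Proposition-1 carrier swapped for one with an inhabited boundary datum, `Regular ≡ ⊤` and NO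
orbits; every other residual letter kept. [cite: Balaban1989LargeFieldI, Prop. 1 (1.78) p.194 (bookkeeping: the typed conjunct reads the residual carrier)] -/
theorem not_b15Leaf_WOfRecord₁₁_swapLF (θ : Stage11Params F N) (lamW : ResidW F N) (P : B12.RunParams) :
    ¬ B15Leaf (WOfRecord₁₁ F N θ
      { lamW with LF := fun _ => ⟨PUnit, fun _ => 0, fun _ => PUnit, fun _ => PEmpty, fun _ _ _ => True, fun _ _ o => o.elim, fun _ _ o => o.elim,
        fun _ o => o.elim, fun _ _ _ => True⟩ } P) :=
  not_b15Leaf_WOfRecord₁₀_swapLF θ.toStage9Params lamW P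

/-- **CENSUS, ₁₁CB10YZW — the LEAF FORM of N12's slot over the Stage-11 W-pinned record predicate is FALSE as soon as the predicate is inhabited.**  Witness:
re-layer the inhabiting record's world with the junk Proposition-1 carrier (`isRecordOfRecord₁₁CB10YZW_reLayerW`); that record's `rBasicStep` leaf IS
`B15Leaf (WOfRecord₁₁ θ λ_junk P)` (g31's `upOfRecord₅C_view₁₁B10YZW_leaves`), which fails (`not_b15Leaf_WOfRecord₁₁_swapLF`).  F-n24T-1 ∕ (R-C1) class, A2: the pin
types (0.2)–(0.6) through OBJECTS but the letters `LF ∕ D189 ∕ D1100` stay residual — so N12 is closable ONLY in the keyed form of §2. [cite: Balaban1989LargeFieldI, Prop. 1 p.194 (as the leaf types it); Balaban1989LargeFieldII, Thm 1 p.355 (bookkeeping census)] -/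
theorem not_atRecord_rBasicStep₁₁CB10YZW (hex : ∃ (F : T4Family) (D : Datum F N) (w : WorldP), IsRecordOfRecord₁₁CB10YZW F N D w) :
    ¬ AtRecord (N := N) (fun F D w => IsRecordOfRecord₁₁CB10YZW F N D w) fun ℓ => ℓ.rBasicStep := by
  intro hall
  obtain ⟨F, D, w, h⟩ := hex
  obtain ⟨θ, Mstar, ops, ζ, lamW, -, -, hre⟩ := isRecordOfRecord₁₁CB10YZW_reLayerW h
  refine not_b15Leaf_WOfRecord₁₁_swapLF θ lamW ⟨0, 0, 0⟩ ((upOfRecord₅C_view₁₁B10YZW_leaves F N θ Mstar ops ζ _ ⟨0, 0, 0⟩).1.1 ?_)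
  exact hall F D _ (hre _) ⟨0, 0, 0⟩

/-- **CENSUS, ₁₁C — the leaf form over def-T's record predicate of record is FALSE as soon as ₁₁C is inhabited** (K0 `Record11Inhabited` gives the hypothesis at
`N = 2`, family by family; neither proved nor assumed here): ₁₁C inhabited ⟹ ₁₁CB10YZW inhabited (the N06 seat's `inhabited₁₁CB10YZW_iff_inhabited₁₁C` BY NAME: rebind with
any floor, def-Y's junk operator layer, any [B11] ∕ [IV] layers), and every ₁₁CB10YZW record is a ₁₁C record at the same world (g31's refinement). [cite: Balaban1989LargeFieldI, Prop. 1 p.194; Balaban1989LargeFieldII, Thm 1 p.355 (bookkeeping census)] -/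
theorem not_atRecord_rBasicStep₁₁C (hex : ∃ (F : T4Family) (D : Datum F N) (w : WorldP), IsRecordOfRecord₁₁C F N D w) :
    ¬ AtRecord (N := N) (fun F D w => IsRecordOfRecord₁₁C F N D w) fun ℓ => ℓ.rBasicStep := by
  intro hall
  obtain ⟨F, D, w, h⟩ := hex
  obtain ⟨D', w', h'⟩ := (inhabited₁₁CB10YZW_iff_inhabited₁₁C F).2 ⟨D, w, h⟩
  exact not_atRecord_rBasicStep₁₁CB10YZW ⟨F, D', w', h'⟩
    fun F₁ D₁ w₁ h₁ P => hall F₁ D₁ w₁ (isRecordOfRecord₁₁C_of_isRecordOfRecord₁₁CB10YZW h₁) P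

end Census

/-! ## §4 GUARD — the ∀-form closer reads the slot back -/

/-- **Under `S_N12` the keyed closer is NOT vacuous and reads the slot back**: if `S_N12` holds at the W-pinned Stage-11 record predicate, then at every presenting package
and every run where `b8`, `PrintedUV3V N θ.L` and `B11Leaf (Z11OfRecord ζ)` hold, the [IV] leaf `B15Leaf (WOfRecord₁₁ θ λ P)` HOLDS — §2 proves nothing weaker than the
slot at every presented, guarded package. [cite: Balaban1989LargeFieldI, Prop. 1 p.194, (0.2)–(0.6) p.176 (bookkeeping)] -/
theorem b15Leaf_of_s_N12_record₁₁CB10YZW (hS : S_N12 (fun F D w => IsRecordOfRecord₁₁CB10YZW F N D w))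
    {F : T4Family} (θ : Stage11Params F N) (h : θ.Provisos₁₁) (Mstar : ℕ) (ops : OpsY N θ.toStage3Params Mstar) (ζ : ResidZ F N) (lamW : ResidW F N)
    {w : WorldP} (hθ : θ.Admissible) (hC : w.C = (datumOfRecord₁₁ F N θ h).C) (hγ : 0 < w.γ ∧ w.γ ≤ θ.γ) (hL : w.L = (θ.L : ℝ))
    (hup : ∀ P, w.up P = upOfRecord₅C F N (θ.view₁₁B10YZW F N Mstar ops ζ lamW) P) {P : B12.RunParams} (h8 : (leavesP w P).b8)
    (h10 : PrintedUV3V N θ.L) (h11 : B11Leaf (Z11OfRecord F N ζ)) : B15Leaf (WOfRecord₁₁ F N θ lamW P) :=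
  s_N12_iff₁₁CB10YZW_bundles.1 hS F θ h Mstar ops ζ lamW w hθ hC hγ hL hup P h8 h10 h11

end Summit.QuantumFields.YangMills.BalabanUVNodes.N12AtRecord11CB10YZW

end
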